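import Mathlib
import Summits.NavierStokesRegularity.NavierStokesRegularity.Theses.TerminalTrace
import HarnessLib

/-!
# `TerminalTrace.Assembly` — the route's assembly (item stmt-NavierStokesRegularity-18386; pure logic)

**Statement.** `TraceDensityCriterion → NoTraceConcentration → BlowupHasSingularPoint → NoBlowupToClay →
NavierStokesRegularity`.

PROOF. NoBlowup holds: at a putative blow-up time `T`, `BlowupHasSingularPoint` gives `xs` with
`‖u‖_{L^∞(Q_r(T,xs))} = ∞` for all `r > 0`, while `NoTraceConcentration` + `TraceDensityCriterion` bound
`u` on some `(T − r², T) × B(xs, r) = Q_r(T, xs)`. Then `NoBlowupToClay` concludes.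

HONEST FRAMING: glue between the route's own statements; nothing here bears on the regularity problem
itself.
-/

noncomputable section

set_option linter.dupNamespace false

namespace Summit.NavierStokesRegularity.NavierStokesRegularity.Theorems

open MeasureTheory Set Function Metric
open scoped ENNReal
open Literature.Analysis Literature.Analysis.FluidPDE

/-- **Item stmt-NavierStokesRegularity-18386** (`TerminalTrace.Assembly`). [this file] -/
theorem terminalTrace_assembly_proof :
    Summit.NavierStokesRegularity.NavierStokesRegularity.Theses.TerminalTrace.Assembly := by
  unfold Summit.NavierStokesRegularity.NavierStokesRegularity.Theses.TerminalTrace.Assembly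
    Summit.NavierStokesRegularity.NavierStokesRegularity.Theses.TerminalTrace.TraceDensityCriterion
    Summit.NavierStokesRegularity.NavierStokesRegularity.Theses.TerminalTrace.NoTraceConcentration
    Summit.NavierStokesRegularity.NavierStokesRegularity.Theses.TerminalTrace.BlowupHasSingularPoint
    Summit.NavierStokesRegularity.NavierStokesRegularity.Theses.TerminalTrace.NoBlowupToClay
  intro hTDC hNTC hBSP hNBC
  refine hNBC fun ν T hν hT u p hcl hLH hdec => ?_
  by_contra hext
  obtain ⟨xs, hxs⟩ := hBSP ν T hν hT u p hcl hLH hdec hext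
  have htr := hNTC ν T hν hT u p hcl hLH hdec xs
  obtain ⟨r, hr, C, hC⟩ := hTDC ν T hν hT u p hcl hLH hdec xs htr
  have hle : eLpNorm (uncurry u) ∞ (volume.restrict (parabolicCylinder r ((T : ℝ), xs))) ≤
      ENNReal.ofReal C := by
    rw [eLpNorm_exponent_top]
    refine eLpNormEssSup_le_of_ae_bound (ae_restrict_of_forall_mem
      (measurableSet_Ioo.prod measurableSet_ball) fun z hz => ?_)
    exact hC z.1 hz.1 z.2 hz.2
  rw [hxs r hr] at hle
  exact absurd hle (not_le.2 ENNReal.ofReal_lt_top)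

end Summit.NavierStokesRegularity.NavierStokesRegularity.Theorems

end
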